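import Literature.Topology.FourManifolds.CappellShanesonDeltaMove
import Literature.Topology.FourManifolds.GompfSectionCircleFramings
import HarnessLib

/-!
# The Δ-move leaf `gompf2010_deltaMove` follows from the framed Thm 2.1, and its concrete form

Sibling proof file of `Literature/Topology/FourManifolds/CappellShanesonDeltaMove.lean` (Gompf's
Theorem 2.1 on the 3-torus in Dehn-twist form), working towards the Δ-move leaf
`Literature.Topology.FourManifolds.gompf2010_deltaMove` of `CappellShanesonGompfReduction.lean`
(R. Gompf, *More Cappell–Shaneson spheres are standard*, Algebr. Geom. Topol. 10 (2010), Thm 2.1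
and §3 ¶3: for `A` in standard form the row move `A ↦ Δᵏ A` does not change the pair of
Cappell–Shaneson spheres) — the tree's single framing-free leaf for Theorem 2.1 on `T³` (D-0026,
2026-08-15: its Dehn-twist rendering, formerly a second named fact, is proved equivalent to it in
`CappellShanesonDeltaMove.lean` and has been merged back into it; this file is phrased for
`gompf2010_deltaMove` throughout).

The decomposition of Gompf's Examples 3.1(a) in this directory also records Theorem 2.1 *framed*,
on Gompf's concrete spheres `X^σ_A = gompfSphere A γ`
(`Literature.Topology.FourManifolds.gompf2010_framedTwist`, **F**, `GompfTheorem43.lean`, §4 ¶3: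
"`X^{τ·σ}_B = X^σ_A`" for `B = Δᵏ A` and `B = A Δᵏ`), which is the form the proof of Theorem 4.3
consumes. Since the classification of Cappell–Shaneson spheres by straightenings is **proved** in
the tree (`Literature.Topology.FourManifolds.gompf2010_straightening_classification_holds`,
`GompfSectionCircleFramings.lean`: every Cappell–Shaneson sphere of `A`, any mapping torus, any
tube, is diffeomorphic to some `gompfSphere A γ`), the framed statement implies the framing-free
leaf, and the leaf is equivalent to a statement about Gompf's concrete spheres only. This file
proves exactly that, so that **F** is the only remaining leaf of Theorem 2.1 for the Δ-moves:

* the four moves under **F** — row/column, forward/backward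
  (`Literature.Topology.FourManifolds.gompf2010_framedTwist.exists_sphere_gompfDelta_zpow_mul`,
  `…exists_sphere_mul_gompfDelta_zpow`, `…exists_sphere_of_gompfDelta_zpow_mul`,
  `…exists_sphere_of_mul_gompfDelta_zpow`; the reverse moves are the moves with `-k` applied to
  the moved matrix, which is again a Cappell–Shaneson matrix in standard form), and
  `Literature.Topology.FourManifolds.gompf2010_deltaMove_of_framedTwist' :
  gompf2010_framedTwist → gompf2010_deltaMove` (`gompf2010_deltaMove_of_framedTwist` of
  `GompfTheorem43.lean` with its classification hypothesis discharged);
* the **unframed concrete form** of the leaf: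
  `Literature.Topology.FourManifolds.gompf2010_deltaMove_of_gompfSphere` — the leaf follows from:
  for every framing path `γ : 1 ⟿ A` (`A` in standard form, `det (A - 1) = 1`) and every `k`,
  `gompfSphere A γ ≅ gompfSphere (Δᵏ A) γ'` for *some* framing path `γ'`; conversely the leaf at
  `Type` implies this (`Literature.Topology.FourManifolds.exists_gompfSphere_diffeomorph_of_deltaMove`),
  whence `Literature.Topology.FourManifolds.gompf2010_deltaMove_iff_gompfSphere` and the universe
  lift `Literature.Topology.FourManifolds.gompf2010_deltaMove_univ`;
* `Literature.Topology.FourManifolds.gompf2010_deltaMove_of_gompfSphere_one` — it suffices to know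
  the concrete form for the two elementary moves `A ↦ Δ A` and `A ↦ Δ⁻¹ A` (induction on `k`;
  Lemma 2.2: "The general case then follows from the case `k = 1`"); the sibling
  `CappellShanesonDeltaMoveOne.lean` removes the second (`A ↦ Δ⁻¹ A` follows from `A ↦ Δ A` by
  conjugation);
* `Literature.Topology.FourManifolds.gompf2010_deltaMove_of_framedTwist_row` — only the row
  clause of **F** is used.

When `gompf2010_framedTwist_holds` lands, `gompf2010_deltaMove_holds` is
`gompf2010_deltaMove_of_framedTwist'` applied to it; until then the leaf is exactly as far away as
Theorem 2.1 proper (fishtail neighbourhood and Lemma 2.2) for `k = 1` on the concrete spheres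
`gompfSphere`, unframed. Also proved: the column-move determinant identity
`det (A Δᵏ - 1) = det (A - 1)` for `A` in standard form
(`Literature.Topology.FourManifolds.IsGompfStandardForm.det_mul_gompfDelta_zpow_sub_one`; the row
version is `IsGompfStandardForm.det_gompfDelta_zpow_mul_sub_one` of
`CappellShanesonGompfReduction.lean`). No named facts are introduced.

## References

* R. E. Gompf, *More Cappell–Shaneson spheres are standard*, Algebr. Geom. Topol. 10 (2010)
  1665–1681, doi:10.2140/agt.2010.10.1665 (arXiv:0908.1914): Thm 2.1 and its proof (fishtail
  neighbourhood, Lemma 2.2), §3 ¶3 (standard form, `δ` isotopic to `Δ`, row and column moves),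
  §4 ¶2–¶3 (`X^σ_A`; `X^{τ·σ}_B = X^σ_A`). [GompfAGT2010]
-/

open scoped Manifold ContDiff Topology
open Set

noncomputable section

namespace Literature.Topology.FourManifolds

universe u

/-! ### The column move preserves the Cappell–Shaneson determinant -/

section Determinant

/-- **Column moves preserve the Cappell–Shaneson condition**: for `A` in standard form,
`det (A Δᵏ - 1) = det (A - 1)` ("`B` is also a Cappell–Shaneson matrix", Gompf 2010, §4 ¶3, for
`B = A Δᵏ`; with `A = !![0, a, b; 0, c, d; 1, e, f]` the polynomial
`det (A - 1) = b - (c - 1)(f - 1) + d e + a d - b c` is unchanged under the column operation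
`(a, c, e) ↦ (a + k b, c + k d, e + k (f - 1))`, i.e.
`A Δᵏ = !![0, a + k b, b; 0, c + k d, d; 1, e + k f - k, f]`). The row version is
`IsGompfStandardForm.det_gompfDelta_zpow_mul_sub_one`. [cite: GompfAGT2010, §§3–4 (Δ-moves preserve Cappell–Shaneson matrices)] -/
theorem IsGompfStandardForm.det_mul_gompfDelta_zpow_sub_one
    {A : Matrix.SpecialLinearGroup (Fin 3) ℤ} (hA : IsGompfStandardForm A) (k : ℤ) :
    (((A * gompfDelta ^ k : Matrix.SpecialLinearGroup (Fin 3) ℤ) : Matrix (Fin 3) (Fin 3) ℤ) -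
        1).det = ((A : Matrix (Fin 3) (Fin 3) ℤ) - 1).det := by
  obtain ⟨h0, h1, h2⟩ := hA
  simp only [Matrix.SpecialLinearGroup.coe_mul, coe_gompfDelta_zpow, Matrix.det_fin_three,
    Matrix.sub_apply, Matrix.mul_apply, Fin.sum_univ_three, Matrix.one_apply, h0, h1, h2]
  simp
  ring

end Determinant

/-! ### From the framed Theorem 2.1 to the framing-free Δ-moves -/

section FramedToFree

/-- **Row move, forward** (Gompf 2010, §3 ¶3 with §4 ¶3): under **F**, every Cappell–Shaneson
sphere `X` of a standard-form Cappell–Shaneson matrix `A` is diffeomorphic to a Cappell–Shaneson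
sphere `X' : Type` of `Δᵏ A` — `X ≅ gompfSphere A γ` by the proved classification, then
`gompfSphere A γ ≅ gompfSphere (Δᵏ A) (γ.deltaLeft k)` by **F**; this is
`gompf2010_deltaMove_of_framedTwist` with the classification discharged. [cite: GompfAGT2010, §3 ¶3 and §4 ¶3 (row move A ↦ Δᵏ A)] -/
theorem gompf2010_framedTwist.exists_sphere_gompfDelta_zpow_mul (hF : gompf2010_framedTwist)
    {A : Matrix.SpecialLinearGroup (Fin 3) ℤ} (hA : IsGompfStandardForm A)
    (hdet : ((A : Matrix (Fin 3) (Fin 3) ℤ) - 1).det = 1) (k : ℤ) (X : Type u) [TopologicalSpace X]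
    [T2Space X] [SecondCountableTopology X] [ChartedSpace (EuclideanSpace ℝ (Fin 4)) X]
    [IsManifold (𝓡 4) ∞ X] [CompactSpace X] (hX : IsCappellShanesonSphereOf A X) :
    ∃ (X' : Type) (_ : TopologicalSpace X') (_ : T2Space X') (_ : SecondCountableTopology X')
      (_ : ChartedSpace (EuclideanSpace ℝ (Fin 4)) X') (_ : IsManifold (𝓡 4) ∞ X')
      (_ : CompactSpace X'),
      IsCappellShanesonSphereOf (gompfDelta ^ k * A) X' ∧ Nonempty (X ≃ₘ⟮𝓡 4, 𝓡 4⟯ X') :=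
  gompf2010_deltaMove_of_framedTwist hF gompf2010_straightening_classification_holds A hA hdet k X
    hX

/-- **Column move, forward** (Gompf 2010, §3 ¶3: "or by the conjugate operation on the second
column"; §4 ¶3 for `B = A Δᵏ`): under **F**, every Cappell–Shaneson sphere `X` of a standard-form
Cappell–Shaneson matrix `A` is diffeomorphic to a Cappell–Shaneson sphere `X' : Type` of `A Δᵏ`,
namely `gompfSphere (A Δᵏ) (γ.deltaRight k)` for the straightening `γ` of `X`. [cite: GompfAGT2010, §3 ¶3 and §4 ¶3 (column move A ↦ A Δᵏ)] -/
theorem gompf2010_framedTwist.exists_sphere_mul_gompfDelta_zpow (hF : gompf2010_framedTwist)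
    {A : Matrix.SpecialLinearGroup (Fin 3) ℤ} (hA : IsGompfStandardForm A)
    (hdet : ((A : Matrix (Fin 3) (Fin 3) ℤ) - 1).det = 1) (k : ℤ) (X : Type u) [TopologicalSpace X]
    [T2Space X] [SecondCountableTopology X] [ChartedSpace (EuclideanSpace ℝ (Fin 4)) X]
    [IsManifold (𝓡 4) ∞ X] [CompactSpace X] (hX : IsCappellShanesonSphereOf A X) :
    ∃ (X' : Type) (_ : TopologicalSpace X') (_ : T2Space X') (_ : SecondCountableTopology X')
      (_ : ChartedSpace (EuclideanSpace ℝ (Fin 4)) X') (_ : IsManifold (𝓡 4) ∞ X')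
      (_ : CompactSpace X'),
      IsCappellShanesonSphereOf (A * gompfDelta ^ k) X' ∧ Nonempty (X ≃ₘ⟮𝓡 4, 𝓡 4⟯ X') := by
  obtain ⟨γ, h⟩ := gompf2010_straightening_classification_holds A X hX
  refine ⟨gompfSphere (A * gompfDelta ^ k) (γ.deltaRight k), inferInstance, inferInstance,
    inferInstance, inferInstance, inferInstance, inferInstance,
    isCappellShanesonSphereOf_gompfSphere _ _ (Or.inl ?_),
    nonempty_diffeomorph_trans h (hF A hA hdet γ k).2⟩
  rw [hA.det_mul_gompfDelta_zpow_sub_one]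
  exact hdet

/-- **Row move, backward**: under **F**, every Cappell–Shaneson sphere of `Δᵏ A` (for `A` a
standard-form Cappell–Shaneson matrix) is diffeomorphic to one of `A` — the forward move with `-k`
applied to `Δᵏ A`, which is again in standard form with `det (· - 1) = 1`
(`gompf2010_deltaMove.of_gompfDelta_zpow_mul`). [cite: GompfAGT2010, §3 ¶3 and §4 ¶3 (row move A ↦ Δᵏ A)] -/
theorem gompf2010_framedTwist.exists_sphere_of_gompfDelta_zpow_mul (hF : gompf2010_framedTwist)
    {A : Matrix.SpecialLinearGroup (Fin 3) ℤ} (hA : IsGompfStandardForm A)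
    (hdet : ((A : Matrix (Fin 3) (Fin 3) ℤ) - 1).det = 1) (k : ℤ) (X : Type u) [TopologicalSpace X]
    [T2Space X] [SecondCountableTopology X] [ChartedSpace (EuclideanSpace ℝ (Fin 4)) X]
    [IsManifold (𝓡 4) ∞ X] [CompactSpace X]
    (hX : IsCappellShanesonSphereOf (gompfDelta ^ k * A) X) :
    ∃ (X' : Type) (_ : TopologicalSpace X') (_ : T2Space X') (_ : SecondCountableTopology X')
      (_ : ChartedSpace (EuclideanSpace ℝ (Fin 4)) X') (_ : IsManifold (𝓡 4) ∞ X')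
      (_ : CompactSpace X'),
      IsCappellShanesonSphereOf A X' ∧ Nonempty (X ≃ₘ⟮𝓡 4, 𝓡 4⟯ X') :=
  (gompf2010_deltaMove_of_framedTwist hF gompf2010_straightening_classification_holds
    ).of_gompfDelta_zpow_mul hA hdet k X hX

/-- **Column move, backward**: under **F**, every Cappell–Shaneson sphere of `A Δᵏ` (for `A` a
standard-form Cappell–Shaneson matrix) is diffeomorphic to one of `A` — the forward column move with
`-k` applied to `A Δᵏ` (standard form by `IsGompfStandardForm.mul_gompfDelta_zpow`, determinant by
`IsGompfStandardForm.det_mul_gompfDelta_zpow_sub_one`), as `A Δᵏ Δ⁻ᵏ = A`. [cite: GompfAGT2010, §3 ¶3 and §4 ¶3 (column move A ↦ A Δᵏ)] -/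
theorem gompf2010_framedTwist.exists_sphere_of_mul_gompfDelta_zpow (hF : gompf2010_framedTwist)
    {A : Matrix.SpecialLinearGroup (Fin 3) ℤ} (hA : IsGompfStandardForm A)
    (hdet : ((A : Matrix (Fin 3) (Fin 3) ℤ) - 1).det = 1) (k : ℤ) (X : Type u) [TopologicalSpace X]
    [T2Space X] [SecondCountableTopology X] [ChartedSpace (EuclideanSpace ℝ (Fin 4)) X]
    [IsManifold (𝓡 4) ∞ X] [CompactSpace X]
    (hX : IsCappellShanesonSphereOf (A * gompfDelta ^ k) X) :
    ∃ (X' : Type) (_ : TopologicalSpace X') (_ : T2Space X') (_ : SecondCountableTopology X')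
      (_ : ChartedSpace (EuclideanSpace ℝ (Fin 4)) X') (_ : IsManifold (𝓡 4) ∞ X')
      (_ : CompactSpace X'),
      IsCappellShanesonSphereOf A X' ∧ Nonempty (X ≃ₘ⟮𝓡 4, 𝓡 4⟯ X') := by
  have h := hF.exists_sphere_mul_gompfDelta_zpow (hA.mul_gompfDelta_zpow k)
    (by rw [hA.det_mul_gompfDelta_zpow_sub_one]; exact hdet) (-k) X hX
  rwa [mul_assoc, ← zpow_add, add_neg_cancel, zpow_zero, mul_one] at h

/-- **The Δ-move leaf from F alone**: `gompf2010_deltaMove` (every Cappell–Shaneson sphere of a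
standard-form `A` is diffeomorphic to one of `Δᵏ A`; Gompf 2010, Thm 2.1 and §3 ¶3) follows from
the framed Theorem 2.1 **F**, the classification hypothesis of
`gompf2010_deltaMove_of_framedTwist` being the proved
`gompf2010_straightening_classification_holds`. When **F** is discharged,
`gompf2010_deltaMove_holds` is this theorem applied to `gompf2010_framedTwist_holds`. [cite: GompfAGT2010, Thm 2.1 and §3 (Δ-moves on matrices in standard form)] -/
theorem gompf2010_deltaMove_of_framedTwist' (hF : gompf2010_framedTwist) :
    gompf2010_deltaMove.{u} :=
  gompf2010_deltaMove_of_framedTwist hF gompf2010_straightening_classification_holds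

end FramedToFree

/-! ### Transport along equal matrices -/

section Transport

/-- Concrete spheres of (propositionally) equal matrices correspond: transport of the framing
path along `B = B'`. [folklore] -/
theorem exists_gompfSphere_diffeomorph_of_eq {B B' : Matrix.SpecialLinearGroup (Fin 3) ℤ}
    (hB : B = B') (γ : SmoothMatrixPath (slRealMatrix B)) :
    ∃ γ' : SmoothMatrixPath (slRealMatrix B'),
      Nonempty (gompfSphere B γ ≃ₘ⟮𝓡 4, 𝓡 4⟯ gompfSphere B' γ') := by
  subst hB
  exact ⟨γ, ⟨Diffeomorph.refl _ _ _⟩⟩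

end Transport

/-! ## The unframed concrete form of the Δ-move leaf `gompf2010_deltaMove`

With the proved classification of Cappell–Shaneson spheres by straightenings, the leaf is
equivalent to a statement about Gompf's concrete spheres `X^γ_A = gompfSphere A γ` only, and it
suffices to know that statement for the two elementary moves (D-0026 record, 2026-08-15: these
reductions were first written for the Dehn-twist rendering of the leaf, a duplicate named fact
since merged back into `gompf2010_deltaMove`; they are kept once, for the leaf itself):

* `Literature.Topology.FourManifolds.gompf2010_deltaMove_of_gompfSphere`,
  `Literature.Topology.FourManifolds.exists_gompfSphere_diffeomorph_of_deltaMove`,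
  `Literature.Topology.FourManifolds.gompf2010_deltaMove_iff_gompfSphere` — the leaf is
  equivalent to its unframed concrete form on Gompf's spheres `X^γ_A = gompfSphere A γ`;
* `Literature.Topology.FourManifolds.gompf2010_deltaMove_univ` — the leaf at `Type` gives it at
  every universe;
* `Literature.Topology.FourManifolds.gompf2010_deltaMove_of_gompfSphere_one` — the moves
  `A ↦ Δ A` and `A ↦ Δ⁻¹ A` suffice (Lemma 2.2: "The general case then follows from the case
  `k = 1`");
* `Literature.Topology.FourManifolds.gompf2010_deltaMove_of_framedTwist_row` — only the row clause
  of **F** is needed.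
-/

section ConcreteDeltaMove

open Function

/-- **The Δ-move leaf from its unframed concrete form.** If for every `A` in standard form with
`det (A - 1) = 1`, every framing path `γ : 1 ⟿ A` and every `k ∈ ℤ` the concrete sphere
`X^γ_A = gompfSphere A γ` is diffeomorphic to `gompfSphere (Δᵏ A) γ'` for some framing path `γ'`,
then `gompf2010_deltaMove` holds: by the classification of Cappell–Shaneson spheres by
straightenings (`gompf2010_straightening_classification_holds`, Gompf §4 ¶2) every sphere of `A`
is some `X^γ_A`, and `gompfSphere (Δᵏ A) γ'` is a Cappell–Shaneson sphere of `Δᵏ A` in `Type`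
(`isCappellShanesonSphereOf_gompfSphere`, with `det (Δᵏ A - 1) = det (A - 1)`). [cite: GompfAGT2010, Thm 2.1, §3 ¶3 and §4 ¶2–¶3] -/
theorem gompf2010_deltaMove_of_gompfSphere
    (h : ∀ (A : Matrix.SpecialLinearGroup (Fin 3) ℤ), IsGompfStandardForm A →
      ((A : Matrix (Fin 3) (Fin 3) ℤ) - 1).det = 1 →
      ∀ (γ : SmoothMatrixPath (slRealMatrix A)) (k : ℤ),
        ∃ γ' : SmoothMatrixPath (slRealMatrix (gompfDelta ^ k * A)),
          Nonempty (gompfSphere A γ ≃ₘ⟮𝓡 4, 𝓡 4⟯ gompfSphere (gompfDelta ^ k * A) γ')) :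
    gompf2010_deltaMove.{u} := by
  intro A hA hdet k X _ _ _ _ _ _ hX
  obtain ⟨γ, hγ⟩ := gompf2010_straightening_classification_holds A X hX
  obtain ⟨γ', hγ'⟩ := h A hA hdet γ k
  refine ⟨gompfSphere (gompfDelta ^ k * A) γ', inferInstance, inferInstance, inferInstance,
    inferInstance, inferInstance, inferInstance,
    isCappellShanesonSphereOf_gompfSphere _ _ (Or.inl ?_), nonempty_diffeomorph_trans hγ hγ'⟩
  rw [hA.det_gompfDelta_zpow_mul_sub_one]
  exact hdet

/-- **Conversely, the Δ-move leaf (at `Type`) gives the unframed concrete form**: the concrete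
sphere `gompfSphere A γ` is a Cappell–Shaneson sphere of `A` in `Type`
(`isCappellShanesonSphereOf_gompfSphere`), the row Δ-move moves it to a sphere of `Δᵏ A`, which
is a concrete `gompfSphere (Δᵏ A) γ'` by the classification. [cite: GompfAGT2010, Thm 2.1, §3 ¶3 and §4 ¶2–¶3] -/
theorem exists_gompfSphere_diffeomorph_of_deltaMove (hΔ : gompf2010_deltaMove.{0})
    {A : Matrix.SpecialLinearGroup (Fin 3) ℤ} (hA : IsGompfStandardForm A)
    (hdet : ((A : Matrix (Fin 3) (Fin 3) ℤ) - 1).det = 1) (γ : SmoothMatrixPath (slRealMatrix A))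
    (k : ℤ) :
    ∃ γ' : SmoothMatrixPath (slRealMatrix (gompfDelta ^ k * A)),
      Nonempty (gompfSphere A γ ≃ₘ⟮𝓡 4, 𝓡 4⟯ gompfSphere (gompfDelta ^ k * A) γ') := by
  obtain ⟨X', _, _, _, _, _, _, h', e⟩ := hΔ A hA hdet k (gompfSphere A γ)
    (isCappellShanesonSphereOf_gompfSphere A γ (Or.inl hdet))
  obtain ⟨γ', hγ'⟩ := gompf2010_straightening_classification_holds _ X' h'
  exact ⟨γ', nonempty_diffeomorph_trans e hγ'⟩

/-- **The Δ-move leaf is equivalent to its unframed concrete form** on Gompf's spheres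
`X^γ_A = gompfSphere A γ`. [cite: GompfAGT2010, Thm 2.1, §3 ¶3 and §4 ¶2–¶3] -/
theorem gompf2010_deltaMove_iff_gompfSphere :
    gompf2010_deltaMove.{0} ↔
      ∀ (A : Matrix.SpecialLinearGroup (Fin 3) ℤ), IsGompfStandardForm A →
        ((A : Matrix (Fin 3) (Fin 3) ℤ) - 1).det = 1 →
        ∀ (γ : SmoothMatrixPath (slRealMatrix A)) (k : ℤ),
          ∃ γ' : SmoothMatrixPath (slRealMatrix (gompfDelta ^ k * A)),
            Nonempty (gompfSphere A γ ≃ₘ⟮𝓡 4, 𝓡 4⟯ gompfSphere (gompfDelta ^ k * A) γ') :=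
  ⟨fun h _ hA hdet γ k ↦ exists_gompfSphere_diffeomorph_of_deltaMove h hA hdet γ k,
    gompf2010_deltaMove_of_gompfSphere⟩

/-- **Universe lift for the Δ-move leaf**: the fact at `Type` implies it at every universe
(through the concrete form, whose spheres live in `Type`). [folklore] -/
theorem gompf2010_deltaMove_univ (hΔ : gompf2010_deltaMove.{0}) : gompf2010_deltaMove.{u} :=
  gompf2010_deltaMove_of_gompfSphere (gompf2010_deltaMove_iff_gompfSphere.1 hΔ)

/-- **It suffices to treat `k = ±1`.** If for every `A` in standard form with `det (A - 1) = 1`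
and every framing path `γ` the concrete sphere `gompfSphere A γ` is diffeomorphic to some concrete
sphere of `Δ A` and to some concrete sphere of `Δ⁻¹ A`, then the unframed concrete form holds for
all `k ∈ ℤ` — induction on `k`, since `Δ^{k ± 1} A = Δ^{±1} (Δᵏ A)` and Δ-moves preserve standard
form and `det (· - 1)` (`IsGompfStandardForm.gompfDelta_zpow_mul`,
`IsGompfStandardForm.det_gompfDelta_zpow_mul_sub_one`) — and hence `gompf2010_deltaMove`
(Gompf, Thm 2.1: the case of general `k` is the `k`-fold twist; proof of Lemma 2.2: "The general
case then follows from the case `k = 1`"). [cite: GompfAGT2010, Thm 2.1 and Lemma 2.2 (proof, reduction to k = 1)] -/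
theorem gompf2010_deltaMove_of_gompfSphere_one
    (h₁ : ∀ (A : Matrix.SpecialLinearGroup (Fin 3) ℤ), IsGompfStandardForm A →
      ((A : Matrix (Fin 3) (Fin 3) ℤ) - 1).det = 1 →
      ∀ γ : SmoothMatrixPath (slRealMatrix A),
        ∃ γ' : SmoothMatrixPath (slRealMatrix (gompfDelta * A)),
          Nonempty (gompfSphere A γ ≃ₘ⟮𝓡 4, 𝓡 4⟯ gompfSphere (gompfDelta * A) γ'))
    (h₂ : ∀ (A : Matrix.SpecialLinearGroup (Fin 3) ℤ), IsGompfStandardForm A →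
      ((A : Matrix (Fin 3) (Fin 3) ℤ) - 1).det = 1 →
      ∀ γ : SmoothMatrixPath (slRealMatrix A),
        ∃ γ' : SmoothMatrixPath (slRealMatrix (gompfDelta⁻¹ * A)),
          Nonempty (gompfSphere A γ ≃ₘ⟮𝓡 4, 𝓡 4⟯ gompfSphere (gompfDelta⁻¹ * A) γ')) :
    gompf2010_deltaMove.{u} := by
  refine gompf2010_deltaMove_of_gompfSphere fun A hA hdet γ k ↦ ?_
  -- the concrete form for all `k`, by induction on `k` (for all `A`, `γ` simultaneously)
  suffices H : ∀ (k : ℤ) (A : Matrix.SpecialLinearGroup (Fin 3) ℤ), IsGompfStandardForm A →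
      ((A : Matrix (Fin 3) (Fin 3) ℤ) - 1).det = 1 →
      ∀ γ : SmoothMatrixPath (slRealMatrix A),
        ∃ γ' : SmoothMatrixPath (slRealMatrix (gompfDelta ^ k * A)),
          Nonempty (gompfSphere A γ ≃ₘ⟮𝓡 4, 𝓡 4⟯ gompfSphere (gompfDelta ^ k * A) γ') from
    H k A hA hdet γ
  intro k
  induction k using Int.induction_on with
  | zero =>
    intro A hA hdet γ
    exact exists_gompfSphere_diffeomorph_of_eq (by rw [zpow_zero, one_mul]) γ
  | succ n ih =>
    intro A hA hdet γ
    obtain ⟨γ₁, h₁'⟩ := ih A hA hdet γ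
    have hA₁ : IsGompfStandardForm (gompfDelta ^ (n : ℤ) * A) := hA.gompfDelta_zpow_mul n
    have hdet₁ : (((gompfDelta ^ (n : ℤ) * A : Matrix.SpecialLinearGroup (Fin 3) ℤ) :
        Matrix (Fin 3) (Fin 3) ℤ) - 1).det = 1 := by
      rw [hA.det_gompfDelta_zpow_mul_sub_one]; exact hdet
    obtain ⟨γ₂, h₂'⟩ := h₁ _ hA₁ hdet₁ γ₁
    obtain ⟨γ₃, h₃'⟩ := exists_gompfSphere_diffeomorph_of_eq
      (show gompfDelta * (gompfDelta ^ (n : ℤ) * A) = gompfDelta ^ ((n : ℤ) + 1) * A by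
        rw [← mul_assoc, ← zpow_one_add, add_comm]) γ₂
    exact ⟨γ₃, nonempty_diffeomorph_trans h₁' (nonempty_diffeomorph_trans h₂' h₃')⟩
  | pred n ih =>
    intro A hA hdet γ
    obtain ⟨γ₁, h₁'⟩ := ih A hA hdet γ
    have hA₁ : IsGompfStandardForm (gompfDelta ^ (-(n : ℤ)) * A) := hA.gompfDelta_zpow_mul _
    have hdet₁ : (((gompfDelta ^ (-(n : ℤ)) * A : Matrix.SpecialLinearGroup (Fin 3) ℤ) :
        Matrix (Fin 3) (Fin 3) ℤ) - 1).det = 1 := by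
      rw [hA.det_gompfDelta_zpow_mul_sub_one]; exact hdet
    obtain ⟨γ₂, h₂'⟩ := h₂ _ hA₁ hdet₁ γ₁
    obtain ⟨γ₃, h₃'⟩ := exists_gompfSphere_diffeomorph_of_eq
      (show gompfDelta⁻¹ * (gompfDelta ^ (-(n : ℤ)) * A) = gompfDelta ^ (-(n : ℤ) - 1) * A by
        rw [← mul_assoc, ← zpow_neg_one, ← zpow_add, neg_add_eq_sub]) γ₂
    exact ⟨γ₃, nonempty_diffeomorph_trans h₁' (nonempty_diffeomorph_trans h₂' h₃')⟩

/-- **The row clause of F suffices for the Δ-move leaf**: the row clause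
"`gompfSphere A γ ≅ gompfSphere (Δᵏ A) (γ.deltaLeft k)`" of **F** alone gives
`gompf2010_deltaMove` (take `γ' = γ.deltaLeft k` in the concrete form). [cite: GompfAGT2010, §4 ¶3 (X^{τ·σ}_B = X^σ_A for B = Δᵏ A) and §3 ¶3] -/
theorem gompf2010_deltaMove_of_framedTwist_row
    (hF : ∀ (A : Matrix.SpecialLinearGroup (Fin 3) ℤ), IsGompfStandardForm A →
      ((A : Matrix (Fin 3) (Fin 3) ℤ) - 1).det = 1 →
      ∀ (γ : SmoothMatrixPath (slRealMatrix A)) (k : ℤ),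
        Nonempty (gompfSphere A γ ≃ₘ⟮𝓡 4, 𝓡 4⟯ gompfSphere (gompfDelta ^ k * A) (γ.deltaLeft k))) :
    gompf2010_deltaMove.{u} :=
  gompf2010_deltaMove_of_gompfSphere fun A hA hdet γ k ↦ ⟨γ.deltaLeft k, hF A hA hdet γ k⟩

end ConcreteDeltaMove

end Literature.Topology.FourManifolds
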